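import Summits.ResolutionOfSingularities.ResolutionOfSingularities.Theorems.FrobeniusClosingPatchingRelPerfectDepthPhaseCAtlasP
import Summits.ResolutionOfSingularities.ResolutionOfSingularities.Theorems.FrobeniusClosingPatchingRelPerfectDepthMultiHostCJSTransportStep
import Summits.ResolutionOfSingularities.ResolutionOfSingularities.Theorems.FrobeniusClosingPatchingRelPerfectDepthTargetsDefs
import Summits.ResolutionOfSingularities.ResolutionOfSingularities.Theorems.FrobeniusClosingPatchingRelPerfectDepthMultiHostResidual
import Literature.AlgebraicGeometry.Resolution.ProjectiveSpaceExcellent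
import Literature.AlgebraicGeometry.Resolution.AlterationsSemiStableCodimTwoBlowupCentre
import Literature.AlgebraicGeometry.Resolution.MonomialMarkedIdealsBlowup
import Literature.Topology.KrullDimensionDrop
import Literature.AlgebraicGeometry.Resolution.HypersurfaceRestriction
import Literature.AlgebraicGeometry.Resolution.BlowupsIntegral
import Literature.AlgebraicGeometry.Resolution.NonPrincipalLocus
import HarnessLib

/-!
# Crux `PatchingRelPerfect` (stmt-ResolutionOfSingularities-16161), chain W5.2 — F7(β) d = 2 (β-AX), X3 C-I:
# THE FIRST `CylReach` CLAUSES (targets v7): THE AMBIENT SCHEME IS INTEGRAL · THE COSUPPORT OF `K` LIES IN THE UNION OF THE MEMBERS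

[OURS · L1 W5.2 · res-L1-w52-lead-1 g6, X3 typer; RULING G11-39 (iii)/(iv) clause discipline («K-level, true at every V = ⊤ state»),
G11-46 A19] Replaces the role of NO printed item; NOT a statement of the manuscript under review; fact-free.

§0: `CylReach.isIntegral` — the ambient scheme of a reachable state is INTEGRAL (generation 1: a blowing up of `Spec S` along a
non-zero ideal; step: blowing up of the proper closed `j(V(C))`), the hypothesis under which «locally principal» upgrades to «effective
Cartier» in the LOCAL END GLUE (…DepthPhaseCLocalGlue).
The clause `Q₀ S cyl :⟺ cosupp S.K ⊆ ⋃_{T ∈ S.𝓔} Supp T` — every point of the cosupport of `K` lies on a MEMBER (the carrier or an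
exceptional member) — holds on every reachable cylinder state:
* `atlasInitial_cosupp_subset_members` — at generation 1 (`AtlasInitial`, targets v6): `𝓘_E² ≤ K` (`DepthInvariant.ker_pow_le`) puts
  `cosupp K` inside `E = range i`, and `range i = range cyl.j` because `j(Z) ⊆ i(ℙ³)` (`InitialShape`) is a closed irreducible subset of the
  same dimension `3` (`Literature.Topology.KrullDimensionDrop`); `cyl.j.ker ∈ S.𝓔` (`CylState.ker_mem`).
* `stepStable_cosupp_subset_members` — under a lifted cylinder step (`StepStable`, v6): `K′ = τᶜ(K, 0) ⊇ τ^* K` (`K_step` with the host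
  orders `host_le_pow_centre`), so `cosupp K′ ⊆ τ⁻¹ cosupp K`; a point over a member `T` lies on the exceptional member (if over the centre) or
  on the strict transform of `T` (off the centre `τ` is a local isomorphism, `IsBlowup.isIso_stalkMap_of_notMem_closure`).
* `CylReach.cosupp_subset_members` — by `CylReach.induct`.
Needed downstream to LOCATE the residual cosupport off `cyl.V` on members (pole sections on the new exceptional member; frozen strata
inside older members), where the carrier analysis (Lemma R, …DepthPhaseCCarrier) is read.

AI-written; AI review is weaker than expert review.

## References
* J. Kollár, *Lectures on Resolution of Singularities* (2007), (3.111) Steps 1–3. [Kollar2007]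
* E. Bierstone, D. Grigoriev, P. Milman, J. Włodarczyk, arXiv:1206.3090, Def. 3.1.3. [BierstoneGrigorievMilmanWlodarczyk2011]
-/

-- `Summit.<Summit>.<Sub>.Theorems` with `Sub = Summit` (single-conjunct summit, D-0017)
set_option linter.dupNamespace false

noncomputable section

open CategoryTheory AlgebraicGeometry TopologicalSpace IsLocalRing Topology
open Literature.AlgebraicGeometry.Resolution
open Scheme.IdealSheafData

namespace Summit.ResolutionOfSingularities.ResolutionOfSingularities.Theorems.ChainW52F7BetaRP

universe u

open DepthMultiHost


/-! ## §0 Reachable ambient schemes are integral -/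

/-- The zero ideal sheaf of a non-empty scheme is not an effective Cartier divisor. [folklore] -/
theorem not_isEffectiveCartier_bot {Y : Scheme.{u}} [Nonempty Y] : ¬ IsEffectiveCartier (⊥ : Y.IdealSheafData) := by
  intro h
  obtain ⟨U, hxU, f, hf, hfU⟩ := h (Classical.arbitrary Y)
  have h0 : f = 0 := by
    have : f ∈ (⊥ : Y.IdealSheafData).ideal U := by rw [hfU]; exact Ideal.mem_span_singleton_self f
    simpa using this
  rw [h0] at hf
  -- the sections over a non-empty affine open are not the zero ring: they map to a local ring
  haveI : Nontrivial Γ(Y, U) := by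
    by_contra hsub
    rw [not_nontrivial_iff_subsingleton] at hsub
    have h1 : (Y.presheaf.germ U _ hxU).hom 1 = (Y.presheaf.germ U _ hxU).hom 0 := by rw [Subsingleton.elim (1 : Γ(Y, U)) 0]
    rw [map_one, map_zero] at h1
    exact one_ne_zero h1
  exact zero_notMem_nonZeroDivisors hf

/-- [OURS · L1 W5.2] **At generation 1 the ambient scheme is integral**: it is a blowing up of `Spec S` (`S` a regular local ring, a domain)
along a non-zero ideal (`DepthInvariant.exists_isBlowup_supported`; non-zero because `X ⊇ j(Z)` is non-empty). [folklore] -/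
theorem atlasInitial_isIntegral : AtlasInitial (fun X _ _ => IsIntegral X) := by
  intro X _ St cyl _ _ hV hZreg hZexc hZdim h𝓔 hXexc hn hshape
  obtain ⟨S, _, _, _, _, κ₀, _, σ, _, x, _, s, P, _, _, g, i, hDI, hrange⟩ := hshape
  obtain ⟨K₀, hg, -⟩ := hDI.exists_isBlowup_supported
  haveI : Nonempty X := ⟨cyl.j (Classical.arbitrary cyl.Z)⟩
  have hK₀ : K₀ ≠ ⊥ := by
    intro h
    have h1 := hg.isEffectiveCartier
    rw [h, Scheme.IdealSheafData.comap_bot] at h1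
    exact not_isEffectiveCartier_bot h1
  haveI := isDomain_of_isRegularLocalRing S
  exact hg.isIntegral hK₀

/-- [OURS · L1 W5.2] **Integrality is step-stable**: the lifted cylinder step blows up the proper closed subset `j(V(C))`
(`C ≠ 0` on the integral carrier). [cite: GortzWedhorn2020, Prop. 13.91] -/
theorem stepStable_isIntegral : StepStable (fun X _ _ => IsIntegral X) := by
  intro X X' _ _ S cyl _ _ C hC0 hCreg hCrad 𝓑 h𝓑 h𝓑C D hD hsub hBsing hperm τ hτ η hη m hm hm' hsncX cyl' τZ hτZ hsq hker htr
    hbd hbdF hV' hlow h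
  haveI : IsIntegral X := h
  haveI := cyl.closedImmersion
  refine hτ.isIntegral fun h0 => ?_
  have huniv : ((cyl.centre C : Closeds X) : Set X) = Set.univ := by
    have := congrArg (fun I : X.IdealSheafData => ((I.support : Closeds X) : Set X)) h0
    simpa [Scheme.IdealSheafData.coe_support_vanishingIdeal] using this
  refine not_mem_support_genericPoint hC0 ?_
  have hz : cyl.j (genericPoint cyl.Z) ∈ (cyl.centre C : Set X) := by rw [huniv]; trivial
  obtain ⟨z', hz', hjz⟩ := (cyl.mem_centre_iff C _).mp hz
  rwa [← cyl.j.isClosedEmbedding.injective hjz]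

/-- [OURS · L1 W5.2] **Reachable ambient schemes are integral.** [folklore] -/
theorem CylReach.isIntegral {X : Scheme.{u}} {S : MultiHostState X} {cyl : CylState S} (h : CylReach S cyl) : IsIntegral X :=
  h.induct stepStable_isIntegral atlasInitial_isIntegral

/-! ## §1 Generation 1 -/

/-- **A closed irreducible subset of full dimension is everything**: for a closed immersion-like embedding `i : P → X` of an irreducible
sober `T₀` space of dimension `d` and a closed `R ⊆ range i` homeomorphic to a space of dimension `d`, `range i ⊆ R`.
[folklore] -/
theorem range_subset_of_topologicalKrullDim_eq {P Z X : Type u} [TopologicalSpace P] [TopologicalSpace Z] [TopologicalSpace X]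
    [QuasiSober P] [T0Space P] [IrreducibleSpace P] {i : P → X} (hi : IsEmbedding i) {j : Z → X} (hj : IsClosedEmbedding j)
    (hji : Set.range j ⊆ Set.range i) (d : ℕ) (hP : topologicalKrullDim P = d) (hZ : topologicalKrullDim Z = d) :
    Set.range i ⊆ Set.range j := by
  by_contra hnot
  -- `W := i⁻¹(range j)`, a proper closed subset of `P`
  have hWc : IsClosed (i ⁻¹' Set.range j) := hj.isClosed_range.preimage hi.continuous
  have hWne : i ⁻¹' Set.range j ≠ Set.univ := by
    intro h
    apply hnot
    rintro _ ⟨p, rfl⟩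
    have : p ∈ i ⁻¹' Set.range j := by rw [h]; trivial
    exact this
  have hlt := Literature.Topology.topologicalKrullDim_lt_of_isClosed_ssubset hWc hWne d (by rw [hP]; exact_mod_cast Nat.lt_succ_self d)
  -- but `W ≅ range j ≅ Z` has dimension `d`
  have e₁ : (i ⁻¹' Set.range j) ≃ₜ Set.range (i ∘ ((↑) : i ⁻¹' Set.range j → P)) :=
    (hi.comp IsEmbedding.subtypeVal).toHomeomorph
  have hrange : Set.range (i ∘ ((↑) : i ⁻¹' Set.range j → P)) = Set.range j := by
    ext x
    constructor
    · rintro ⟨⟨p, hp⟩, rfl⟩; exact hp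
    · intro hx
      obtain ⟨p, rfl⟩ := hji hx
      exact ⟨⟨p, hx⟩, rfl⟩
  have e₂ : Set.range (i ∘ ((↑) : i ⁻¹' Set.range j → P)) ≃ₜ Set.range j := Homeomorph.setCongr hrange
  have e₃ : Z ≃ₜ Set.range j := hj.toIsEmbedding.toHomeomorph
  have hdimW : topologicalKrullDim (i ⁻¹' Set.range j) = d := by
    rw [IsHomeomorph.topologicalKrullDim_eq _ (e₁.trans (e₂.trans e₃.symm)).isHomeomorph, hZ]
  rw [hdimW] at hlt
  exact lt_irrefl _ hlt

/-- [OURS · L1 W5.2] **Q₀ at generation 1**: `cosupp K ⊆ ⋃ members` holds for every `AtlasInitial` state (targets v6). [folklore] -/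
theorem atlasInitial_cosupp_subset_members :
    AtlasInitial (fun X S _ => (S.K.support : Set X) ⊆ ⋃ T ∈ S.𝓔, (T.support : Set X)) := by
  intro X _ St cyl _ _ hV hZreg hZexc hZdim h𝓔 hXexc hn hshape
  obtain ⟨S, _, _, _, _, κ₀, _, σ, _, x, _, s, P, _, _, g, i, hDI, hrange⟩ := hshape
  haveI := hDI.isClosedImmersion
  haveI := cyl.closedImmersion
  obtain ⟨hPint, -, -, -, hdimP⟩ := ProjectiveSpace.projSpace_standing 3 κ₀
  haveI := hPint
  -- `range i ⊆ range j` by dimension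
  have hdimZ : topologicalKrullDim cyl.Z = ((3 : ℕ) : WithBot ℕ∞) := by rw [hZdim]; norm_cast
  have hij : Set.range i.base ⊆ Set.range cyl.j.base :=
    range_subset_of_topologicalKrullDim_eq i.isClosedEmbedding.toIsEmbedding cyl.j.isClosedEmbedding hrange 3 hdimP hdimZ
  -- `cosupp K ⊆ Supp 𝓘_E = range i`
  intro y hy
  have h1 : y ∈ ((i.ker ^ 2).support : Set X) := support_antitone hDI.ker_pow_le hy
  rw [Scheme.IdealSheafData.support_pow _ 2 two_ne_zero, Scheme.Hom.support_ker, i.isClosedEmbedding.isClosed_range.closure_eq] at h1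
  refine Set.mem_iUnion₂.mpr ⟨cyl.j.ker, cyl.ker_mem, ?_⟩
  rw [Scheme.Hom.support_ker, cyl.j.isClosedEmbedding.isClosed_range.closure_eq]
  exact hij h1

/-! ## §2 Step-stability -/

/-- [OURS · L1 W5.2] **Q₀ is step-stable** (targets v6 `StepStable`): `cosupp K′ ⊆ τ⁻¹ cosupp K` and a point over a member lies on the
exceptional member or on the strict transform of that member. [cite: Kollar2007, (3.111) Step 1] -/
theorem stepStable_cosupp_subset_members :
    StepStable (fun X S _ => (S.K.support : Set X) ⊆ ⋃ T ∈ S.𝓔, (T.support : Set X)) := by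
  intro X X' _ _ S cyl _ _ C hC0 hCreg hCrad 𝓑 h𝓑 h𝓑C D hD hsub hBsing hperm τ hτ η hη m hm hm' hsncX cyl' τZ hτZ hsq hker htr hbd hbdF hV' hlow h x' hx'
  -- `K′ ⊇ τ^* K`
  have hA : ∀ i, S.host i ≤ vanishingIdeal (cyl.centre C) ^ m i := fun i => MultiHostCJS.host_le_pow_centre cyl C (hm i)
  have hK' := S.K_step τ (cyl.centre C) η m 0 hsncX hτ hη hA (fun i => Nat.zero_le _)
  have hle : S.K.comap τ ≤ (S.step τ (cyl.centre C) η m 0 hsncX hτ).K := by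
    rw [hK']; exact comap_le_controlledTransform τ _ _ 0
  have h1 : τ x' ∈ (S.K.support : Set X) := (mem_support_comap_iff τ S.K x').mp (support_antitone hle hx')
  obtain ⟨T, hT, hxT⟩ := Set.mem_iUnion₂.mp (h h1)
  rw [MultiHostState.step_𝓔]
  by_cases hW : τ x' ∈ (cyl.centre C : Set X)
  · -- over the centre: the exceptional member
    refine Set.mem_iUnion₂.mpr ⟨(vanishingIdeal (cyl.centre C)).comap τ, List.mem_append_right _ (List.mem_singleton_self _), ?_⟩
    rw [mem_support_comap_iff, Scheme.IdealSheafData.coe_support_vanishingIdeal]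
    exact hW
  · -- off the centre: `τ` is a local isomorphism, the strict transform of `T` passes through `x′`
    refine Set.mem_iUnion₂.mpr ⟨strictTransformIdeal τ (vanishingIdeal (cyl.centre C)) T,
      List.mem_append_left _ (List.mem_map.mpr ⟨T, hT, rfl⟩), ?_⟩
    have hnotC : τ x' ∉ (vanishingIdeal (cyl.centre C)).support := by
      rw [← SetLike.mem_coe, Scheme.IdealSheafData.coe_support_vanishingIdeal]; exact hW
    have hWeq : (⟨closure {η}, isClosed_closure⟩ : Closeds X) = cyl.centre C := Closeds.ext hη
    have hτ' : IsBlowup τ (vanishingIdeal ⟨closure {η}, isClosed_closure⟩) := by rw [hWeq]; exact hτ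
    have hnot : τ x' ∉ closure {η} := by rw [show closure {η} = (cyl.centre C : Set X) from hη]; exact hW
    haveI := hτ'.isIso_stalkMap_of_notMem_closure hnot
    have hbij : Function.Bijective (τ.stalkMap x').hom := ConcreteCategory.bijective_of_isIso _
    have hst := stalkIdeal_strictTransformIdeal_of_not_mem_support (vanishingIdeal (cyl.centre C)) T hnotC
    show x' ∈ (strictTransformIdeal τ (vanishingIdeal (cyl.centre C)) T).support
    rw [mem_support_iff_stalkIdeal_le, hst]
    apply IsLocalRing.le_maximalIdeal
    intro htop
    have h2 := congrArg (Ideal.comap (τ.stalkMap x').hom) htop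
    rw [Ideal.comap_map_of_bijective _ hbij, Ideal.comap_top] at h2
    have h3 := (mem_support_iff_stalkIdeal_le T _).mp hxT
    rw [h2] at h3
    exact (maximalIdeal.isMaximal _).ne_top (top_le_iff.mp h3)

/-! ## §3 The clause on reachable states -/

/-- [OURS · L1 W5.2] **THE FIRST `CylReach` CLAUSE**: on every reachable cylinder state the cosupport of `K` lies in the union of the
members. [cite: Kollar2007, (3.111) Steps 1–3] -/
theorem CylReach.cosupp_subset_members {X : Scheme.{u}} {S : MultiHostState X} {cyl : CylState S} (h : CylReach S cyl) :
    (S.K.support : Set X) ⊆ ⋃ T ∈ S.𝓔, (T.support : Set X) :=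
  h.induct stepStable_cosupp_subset_members atlasInitial_cosupp_subset_members

/-- The same for the RESIDUAL cosupport (`cosupp K♭ ⊆ cosupp K`, A8) — where Phase C works. [folklore] -/
theorem CylReach.residual_cosupp_subset_members {X : Scheme.{u}} {S : MultiHostState X} {cyl : CylState S} (h : CylReach S cyl) :
    (S.residual.K.support : Set X) ⊆ ⋃ T ∈ S.𝓔, (T.support : Set X) :=
  S.residual_K_support_subset.trans h.cosupp_subset_members


/-- [OURS · L1 W5.2] **Corollary: off the cylinder region the cosupport lies on the NON-CARRIER members** (the exceptional members): the
carrier's support `range cyl.j` is inside `cyl.V` (`CylState.range_j_subset`). This is where poles and frozen strata live. [folklore] -/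
theorem CylReach.cosupp_diff_V_subset {X : Scheme.{u}} {S : MultiHostState X} {cyl : CylState S} (h : CylReach S cyl) :
    (S.K.support : Set X) \ (cyl.V : Set X) ⊆ ⋃ T ∈ S.𝓔, ⋃ (_ : T ≠ cyl.j.ker), (T.support : Set X) := by
  intro x hx
  obtain ⟨T, hT, hxT⟩ := Set.mem_iUnion₂.mp (h.cosupp_subset_members hx.1)
  refine Set.mem_iUnion₂.mpr ⟨T, hT, Set.mem_iUnion.mpr ⟨?_, hxT⟩⟩
  rintro rfl
  haveI := cyl.closedImmersion
  have hr : x ∈ Set.range cyl.j.base := by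
    have := hxT
    rw [Scheme.Hom.support_ker, cyl.j.isClosedEmbedding.isClosed_range.closure_eq] at this
    exact this
  exact hx.2 (cyl.range_j_subset hr)

end Summit.ResolutionOfSingularities.ResolutionOfSingularities.Theorems.ChainW52F7BetaRP

end
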